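import Summits.Parity.BatemanHorn.Theorems.AlmostPrimeZerosSystemLSDRealSegmentLinearKernel
import Summits.Parity.BatemanHorn.Theorems.AlmostPrimeZerosSystemLSDRealSegmentReduction
import HarnessLib

/-!
# Route `AlmostPrimeZeros`, crux `SystemLSDRealSegment` (stmt-Parity-11292), line
# `beta-thinned-root-kernel`: the crux for LINEAR systems, with `Λ = λ_f`

Corollaries of the linear kernel law `betaKernelLaw_of_natDegree_eq_one`
(`Theorems/AlmostPrimeZerosSystemLSDRealSegmentLinearKernel.lean`) and the reduction
(`Theorems/AlmostPrimeZerosSystemLSDRealSegmentReduction.lean`: the Type-I half `typeILaw_holds` is a theorem for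
every Bateman–Horn system, the split `M_x = T_x + K_x` is exact, and `eulerFactorClause_holds`): for every
Bateman–Horn system `f : Fin 1 → ℤ[X]` with `deg f₀ = 1` (all `aX + b`; in particular the calibration instance `f = X`,
the standing disprover's `LinearInstance`) the conclusion of the crux HOLDS, unconditionally, with the explicit
`Λ = λ_f = eulerFactor f` (`D = 1`):
* `segmentLaw_of_natDegree_eq_one` (registered name) — the real-segment law on `(5/4, 7/4)`;
* `conclusion_of_natDegree_eq_one` — the full `∃ Λ` clause of `SystemLSDRealSegment` at `k = 1`, `deg = 1`.
-/

open Filter Finset Polynomial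
open scoped BigOperators Topology

namespace Summit.Parity.BatemanHorn.Cruxes.SystemLSDRealSegment.BetaThinnedRootKernel

open Literature.NumberTheory.Sieve

noncomputable section

/-- **The real-segment law for LINEAR Bateman–Horn systems, `Λ = λ_f`** (the `k = 1`, `deg f₀ = 1` instance of the
crux `SystemLSDRealSegment`'s limit clause with the explicit Euler factor): for `f : Fin 1 → ℤ[X]` a Bateman–Horn
system with `deg f₀ = 1` and `5/4 < y < 7/4`,
`x⁻¹ exp((1−y) log log x) Σ_{n ≤ x} y^{s_f(n)} → eulerFactor f y · exp((y−1) log D) · Γ(y)^{−1}` (`D = 1`).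
By `betaKernelLaw_iff_segmentLaw` from `betaKernelLaw_of_natDegree_eq_one`. [folklore] -/
theorem segmentLaw_of_natDegree_eq_one : ∀ (f : Fin 1 → ℤ[X]), IsBatemanHornSystem f →
    (f 0).natDegree = 1 → ∀ y : ℝ, 5 / 4 < y → y < 7 / 4 →
      Tendsto (fun x : ℕ => (x : ℂ)⁻¹ * Complex.exp (((1 : ℕ) : ℂ) * (1 - (y : ℂ)) * (Real.log (Real.log x) : ℂ)) *
          ∑ n ∈ range (x + 1), (y : ℂ) ^ (∑ i, (((f i).eval (n : ℤ)).toNat.factorization.sum fun _ v => min v 2)))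
        atTop
        (𝓝 (eulerFactor f y * Complex.exp (((y : ℂ) - 1) * (Real.log (∏ i, ((f i).natDegree : ℝ)) : ℂ)) *
          (Complex.Gamma y)⁻¹ ^ (1 : ℕ))) :=
  fun f hf hdeg y hy _ =>
    (betaKernelLaw_iff_segmentLaw hf (by linarith)).1 (betaKernelLaw_of_natDegree_eq_one f hf hdeg y (by linarith))

/-- **The crux `SystemLSDRealSegment` HOLDS for linear systems** (`k = 1`, `deg f₀ = 1`: every Bateman–Horn system
`aX + b`, in particular `f = X`), with the witness `Λ := eulerFactor f`: holomorphic on `|z| < 2`, `Λ(0) = C(f)`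
(`eulerFactorClause_holds`), and the real-segment law on `(5/4, 7/4)` (`segmentLaw_of_natDegree_eq_one`).  This is
verbatim the body of `Summit.Parity.BatemanHorn.Theses.AlmostPrimeZeros.SystemLSDRealSegment` at `k = 1` under the
extra hypothesis `deg f₀ = 1`. [folklore] -/
theorem conclusion_of_natDegree_eq_one : ∀ (f : Fin 1 → ℤ[X]), IsBatemanHornSystem f →
    (f 0).natDegree = 1 →
      ∃ Λ : ℂ → ℂ, DifferentiableOn ℂ Λ (Metric.ball 0 2) ∧ Λ 0 = (batemanHornConst f : ℂ) ∧
        ∀ y : ℝ, 5 / 4 < y → y < 7 / 4 →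
          Tendsto (fun x : ℕ => (x : ℂ)⁻¹ *
              Complex.exp (((1 : ℕ) : ℂ) * (1 - (y : ℂ)) * (Real.log (Real.log x) : ℂ)) *
              ∑ n ∈ range (x + 1),
                (y : ℂ) ^ (∑ i, (((f i).eval (n : ℤ)).toNat.factorization.sum fun _ v => min v 2)))
            atTop
            (𝓝 (Λ y * Complex.exp (((y : ℂ) - 1) * (Real.log (∏ i, ((f i).natDegree : ℝ)) : ℂ)) *
              (Complex.Gamma y)⁻¹ ^ (1 : ℕ))) :=
  fun f hf hdeg =>
    ⟨eulerFactor f, (eulerFactorClause_holds 1 f hf).1, (eulerFactorClause_holds 1 f hf).2,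
      fun y hy hy' => segmentLaw_of_natDegree_eq_one f hf hdeg y hy hy'⟩

end

end Summit.Parity.BatemanHorn.Cruxes.SystemLSDRealSegment.BetaThinnedRootKernel
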